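import Mathlib.Analysis.ODE.Gronwall
import Mathlib.Analysis.Calculus.ContDiff.Basic
import HarnessLib

/-!
# Crux `FiniteDissipationLiouville` (stmt-NavierStokesRegularity-22144): a decaying field that is
# constant along itself vanishes — `(Ω·∇)Ω ≡ 0` and `Ω → 0` at infinity force `Ω ≡ 0`

Theorems file of route `LerayQuarterDissipation` (lead prover g14; `--supports` the crux; file 2 of
the THRESHOLD-ONE chain). Navier–Stokes regularity is NOT proved by anything here; no summit is.
Pure calculus, no fluid mechanics:

* `apply_line_eq_of_fderiv_apply_self_eq_zero` — if `Ω : E → E` is `C¹` with `‖DΩ‖ ≤ M` and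
  `DΩ(y)[Ω(y)] = 0` for every `y`, then `Ω` is constant along the straight line through any point
  in the direction of its own value there: `Ω(y₀ + τ Ω(y₀)) = Ω(y₀)` for all `τ ≥ 0` (the defect
  `g(τ) = Ω(y₀ + τ v) − v`, `v = Ω(y₀)`, solves the linear ODE `g' = −DΩ(y₀ + τ v) g` with
  `g(0) = 0`; Grönwall).
* `eq_zero_of_fderiv_apply_self_eq_zero` — **if moreover `Ω → 0` at infinity then `Ω ≡ 0`**: along
  the line the constant value `v ≠ 0` would have to tend to `0`.

Use (`…ThresholdOne`): at the law-free threshold `C = 1` the equality case of the similarity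
enstrophy budget forces, on the limit profile, `‖U‖ = 1` wherever `(Ω·∇)Ω ≠ 0`; so either `‖U‖ ≡ 1`
on an open set (impossible for an analytic decaying profile) or `(Ω·∇)Ω ≡ 0`, which this file turns
into `Ω ≡ 0`. In fluid language: a vorticity field whose vortex lines are straight and carry a
constant vorticity cannot decay unless it vanishes.

References: Grönwall's inequality (Mathlib `norm_le_gronwallBound_of_norm_deriv_right_le`).
-/

noncomputable section

set_option linter.dupNamespace false

namespace Summit.NavierStokesRegularity.NavierStokesRegularity.Theorems.FiniteDissipationLiouville.ThresholdOne

open Set Filter Topology Metric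

variable {E : Type*} [NormedAddCommGroup E] [NormedSpace ℝ E]

/-- **A field annihilated by its own derivative is constant along its own lines.** If `Ω` is `C¹`,
`‖DΩ(y)‖ ≤ M` and `DΩ(y)[Ω(y)] = 0` for all `y`, then `Ω(y₀ + τ • Ω(y₀)) = Ω(y₀)` for every
`τ ≥ 0` (Grönwall for `g(τ) = Ω(y₀ + τ v) − v`, which satisfies `‖g'‖ ≤ M‖g‖`, `g(0) = 0`). [folklore] -/
theorem apply_line_eq_of_fderiv_apply_self_eq_zero {Ω : E → E} (hΩ : ContDiff ℝ 1 Ω) {M : ℝ}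
    (hM : ∀ y, ‖fderiv ℝ Ω y‖ ≤ M) (hself : ∀ y, fderiv ℝ Ω y (Ω y) = 0) (y₀ : E) {τ : ℝ}
    (hτ : 0 ≤ τ) : Ω (y₀ + τ • Ω y₀) = Ω y₀ := by
  set v : E := Ω y₀ with hv
  set g : ℝ → E := fun σ => Ω (y₀ + σ • v) - v with hg
  have hd : ∀ y, DifferentiableAt ℝ Ω y := fun y => hΩ.differentiable one_ne_zero y
  -- the derivative of `g`
  have hline : ∀ σ : ℝ, HasDerivAt (fun σ : ℝ => y₀ + σ • v) v σ := fun σ => by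
    simpa using ((hasDerivAt_id σ).smul_const v).const_add y₀
  have hg' : ∀ σ : ℝ, HasDerivAt g (fderiv ℝ Ω (y₀ + σ • v) v) σ := fun σ => by
    have h := ((hd (y₀ + σ • v)).hasFDerivAt.comp_hasDerivAt σ (hline σ)).sub_const v
    simpa [hg] using h
  -- `g' = -DΩ g`, hence `‖g'‖ ≤ M‖g‖`
  have hbound : ∀ σ : ℝ, ‖fderiv ℝ Ω (y₀ + σ • v) v‖ ≤ M * ‖g σ‖ + 0 := by
    intro σ
    have e : fderiv ℝ Ω (y₀ + σ • v) v = -(fderiv ℝ Ω (y₀ + σ • v) (g σ)) := by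
      have h0 := hself (y₀ + σ • v)
      have hsplit : Ω (y₀ + σ • v) - g σ = v := by simp [hg]
      calc fderiv ℝ Ω (y₀ + σ • v) v = fderiv ℝ Ω (y₀ + σ • v) (Ω (y₀ + σ • v) - g σ) := by
            rw [hsplit]
        _ = fderiv ℝ Ω (y₀ + σ • v) (Ω (y₀ + σ • v)) - fderiv ℝ Ω (y₀ + σ • v) (g σ) :=
            map_sub _ _ _
        _ = -(fderiv ℝ Ω (y₀ + σ • v) (g σ)) := by rw [h0, zero_sub]
    rw [e, norm_neg, add_zero]
    exact (ContinuousLinearMap.le_opNorm _ _).trans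
      (mul_le_mul_of_nonneg_right (hM _) (norm_nonneg _))
  have hcont : Continuous g := by
    have : Continuous fun σ : ℝ => y₀ + σ • v := by fun_prop
    exact (hΩ.continuous.comp this).sub continuous_const
  have hg0 : ‖g 0‖ ≤ 0 := by simp [hg, hv]
  have hG := norm_le_gronwallBound_of_norm_deriv_right_le (f := g)
    (f' := fun σ => fderiv ℝ Ω (y₀ + σ • v) v) (δ := 0) (K := M) (ε := 0) (a := 0) (b := τ)
    hcont.continuousOn (fun σ _ => (hg' σ).hasDerivWithinAt) hg0 (fun σ _ => hbound σ) τ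
    ⟨hτ, le_rfl⟩
  rw [gronwallBound_ε0_δ0] at hG
  have hz : g τ = 0 := norm_le_zero_iff.1 hG
  have : Ω (y₀ + τ • v) - v = 0 := hz
  exact sub_eq_zero.1 this

/-- **A DECAYING FIELD CONSTANT ALONG ITSELF VANISHES.** If `Ω : E → E` is `C¹` with bounded
derivative, `DΩ(y)[Ω(y)] = 0` for all `y`, and `Ω → 0` at infinity (`‖Ω(y)‖ < ε` for `‖y‖ ≥ R(ε)`),
then `Ω ≡ 0`: a nonzero value `v = Ω(y₀)` would persist along the whole ray `y₀ + τ v`, `τ ≥ 0`,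
which leaves every ball. [folklore] -/
theorem eq_zero_of_fderiv_apply_self_eq_zero {Ω : E → E} (hΩ : ContDiff ℝ 1 Ω) {M : ℝ}
    (hM : ∀ y, ‖fderiv ℝ Ω y‖ ≤ M) (hself : ∀ y, fderiv ℝ Ω y (Ω y) = 0)
    (hdecay : ∀ ε : ℝ, 0 < ε → ∃ R : ℝ, ∀ y, R ≤ ‖y‖ → ‖Ω y‖ < ε) :
    ∀ y, Ω y = 0 := by
  intro y₀
  by_contra hne
  set v : E := Ω y₀ with hv
  have hvpos : 0 < ‖v‖ := norm_pos_iff.2 hne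
  obtain ⟨R, hR⟩ := hdecay (‖v‖ / 2) (by positivity)
  -- a point of the ray outside the ball of radius `R`
  set τ : ℝ := (|R| + ‖y₀‖) / ‖v‖ with hτ
  have hτ0 : 0 ≤ τ := by positivity
  have hfar : R ≤ ‖y₀ + τ • v‖ := by
    have h1 : ‖τ • v‖ = |R| + ‖y₀‖ := by
      rw [norm_smul, Real.norm_of_nonneg hτ0, hτ, div_mul_cancel₀ _ hvpos.ne']
    have h2 : ‖τ • v‖ - ‖y₀‖ ≤ ‖y₀ + τ • v‖ := by
      have := norm_sub_norm_le (τ • v) (-y₀)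
      rw [norm_neg, sub_neg_eq_add, add_comm] at this
      linarith
    have h3 : R ≤ |R| := le_abs_self R
    linarith
  have hsmall := hR _ hfar
  rw [apply_line_eq_of_fderiv_apply_self_eq_zero hΩ hM hself y₀ hτ0] at hsmall
  linarith

end Summit.NavierStokesRegularity.NavierStokesRegularity.Theorems.FiniteDissipationLiouville.ThresholdOne

end
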